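import Summits.Schanuel.Schanuel.Theorems.RootDecomp1KArcCell05

/-!
# RootDecomp1KArcCell — lens 1, generation 50, node 9 «THE ARC ENGINE: separation by positive-dimensional containment; members ρ° = Π(1+4^(−k!)) and the twin σ° = Π(1+2·4^(−k!)); item 33364 decided hyp-free at zA = (1, ℓ₂, ρ°), zD = (1, ρ°, σ°) and π-twins» — continuation (RootDecomp1KArcCell06): §6 the arc cell, its walls, item-shape instances + §7 head the members zA / zApi

(lens-1 g50 HOME kernel K = HOME/decomp-schanuel-lens-1/g50/ArcCell.lean 10f1e0d5…, 3410 l · 258 decl lines, imports …RootDecomp1KCollarWall05 + …RootDecomp1KCommonRadixCell04 + …RootDecomp1KNWMeasureHolds BY NAME; P ArcCellProbe.lean af7624ff… rc 0 / C₀ ArcCellCtrl0.lean d71f613e… rc 0 / C ArcCellCtrl.lean 242a3b02… rc 1 = 42 planted; memo NODE-g50.md; CLAIM L2466, EX-ANTE PRICE + CHECKLIST K-g50 L2467, NODE L2469 / REQUEST L2470 (with the lens's ex-post self-correction: both members fall to printed dominance in substance — zA directly by Bundschuh LNM 1415 p.78 / Zhu 推论 1.3.3, zD after τ = σ°/ρ°²);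 critic VERDICT L2473: CLEARED AS PRICED EX ANTE — ONE CELL ×1 «ARC CELL (TYPED-LEVEL)» with the SUBSTANCE CAVEAT OF RECORD (both members inside the archimedean dominance class in substance; E2 convenient, not necessary), RULE K-R39 FIXED, PORT GO. Port by census-1 gen 21 as `RootDecomp1KArcCell01–13` along K's §1–§12 with §4, §7 and §12 cut at decl boundaries by the 400-line file cap: 01 = §1 (E1) `aeval_one_div_two_pow_ne_zero` (dyadic root lemma) + §2 (E2) `toPolyPoly`, `arc_count` (a relation contains ≤ deg q of an injective family of rational arcs — roots over the domain ℚ[X]); 02 = §3 (A) the member: `dfac`, `arcNum`, `arcProdQ` (ρ°_N), `sQ`, `rhoArc` (ρ° = Π(1 + 4^(−k!))) and its tails; 03 = §4a (E3) `TruncGenericSeq` («[class] definition» tag) + **`algebraicIndependent_of_truncGenericSeq`** (the g36/g37 extraction re-plumbed to arbitrary dyadic-type schedules); 04 = §4b `psQ`, the link `truncGeneric_iff_truncGenericSeq` and the tree (X′) re-derived — K's `theorem algebraicIndependent_liouville_of_truncGeneric'` DEMOTED to a documented `example` (its statement is byte-identical to the tree's `RootDecomp1KCommonRadixCell.algebraicIndependent_liouville_of_truncGeneric`,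 CommonRadixCell03 l.98 — dedup twin flagged by the writer L2472 (α), demotion pre-sanctioned by the critic L2473; nothing in K uses the primed name); 05 = §5 the arcs of ρ°: `arcPoly`, `arcF`, `arcBasis`, `arcScal`, `clearArc`, `truncGenericSeq_arc`, tightness `qArc` / `qArc_tight`; 06 = §6 the arc cell `algebraicIndependent_arc_of_mvPolyMeasure`, `algebraicIndependent_rhoArc_ell2`, walls `sb_arcWall3(_pi)`, item-shape instances + §7 head `zA` / `zApi`, `linearIndependent_zA(pi)`, `linLiouville_zA(pi)`; 07 = §7a the ONE 2-adic cut `cutA` + **`form_lower_bound_A`** (exponent 9), `not_hyperLinLiouville_zA(pi)` (m₀ = 10), `sb_zA(pi)`, `finiteOrderLiouvilleSchanuel_at_zA(pi)`, `item33364_at_zA(pi)`, `item31077_at_zA`; 08 = §8 `rhoArc_position` (11 conjuncts by tree name) and its lemmas, `liouville_rhoArc`; 09 = §9 (A′) the twin σ° = Π(1 + 2·4^(−k!)): `arcNum2`, `arcOdd2`, `arcProdQ2`, `sigmaArc`, `liouville_sigmaArc`; 10 = §10 the lines of (ρ°, σ°): `linPoly`, `linF`, `linBasis`, `linScal`, `clearLin`,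 `truncGenericSeq_lin`, `qLin` / `qLin_tight`; 11 = §11 the twin cell `algebraicIndependent_twin_of_mvPolyMeasure`, walls `sb_twinWall3(_pi)`, item-shape instances + §12 head `zD` / `zDpi`, binders; 12 = §12a part 1 the archimedean two-level cut `cutD`, `cutD_succ_ne_zero`, `cutD_height_bound`; 13 = §12a part 2 **`form_lower_bound_D`** (exponent 7), `not_hyperLinLiouville_zD(pi)` (m₀ = 8), `sb_zD(pi)`, `item33364_at_zD(pi)`, `zD_shape`. PORT EDITS (census convention): `set_option linter.dupNamespace false` dropped; 77 one-line helper docstrings added (statements quoted); per-part private helper copies; sections `Extraction` / `Members` / `TwinMembers` closed and re-opened across the cuts with their `variable` / `open` lines; statements and proofs otherwise verbatim (no renames; K's own private markers kept). `--supports stmt-Schanuel-33364`; no census credit carried; rung 0 — nothing here proves Schanuel; no ∀-item moves; 33364, 33363, 31077 stay OPEN.)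
-/

noncomputable section

open Polynomial LiouvilleNumber
open scoped Nat

namespace Summit.Schanuel.Schanuel.Theorems.RootDecomp1KArcCell

open Summit.Schanuel.Schanuel.Theorems.RootDecomp1KCollarCell
open Summit.Schanuel.Schanuel.Theorems.RootDecomp1KGapCell
open Summit.Schanuel.Schanuel.Theorems.RootDecomp1KTwoBaseCell
open Summit.Schanuel.Schanuel.Theorems.RootDecomp1KRelLiouvilleCell
open Summit.Schanuel.Schanuel.Theorems.RootDecomp1KNWMeasureHolds (polyMeasure_exp_one_holds)
open Summit.Schanuel.Schanuel.Theorems.RootDecomp1KHyper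
open Summit.Schanuel.Schanuel.Theorems.RootDecomp1KHyper.HyperCell
open Summit.Schanuel.Schanuel.Theorems.RootDecomp1KCommonRadixCell (TruncGeneric algebraicIndependent_liouville_of_truncGeneric)

/-! ## §6  THE ARC CELL, ITS WALLS `SB 3 (1, ℓ₂, ρ°)` / π-twin, and the ITEM-SHAPE instances — HYPOTHESIS-FREE

(E3) at the certified pair `x = (ρ°_N, s_N)` (denominators `≤ 2^{4N!}`, values `≤ 3`, tails `≤ 8/2^{(N+1)!}`) and the
generic-sequence certificate `truncGenericSeq_arc` (E1+E2) give the CELL; the tree's `sb_of_algebraicIndependent` (Hyper04),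
`mvPolyMeasure_one_of_polyMeasure` (RelLiouvilleCell05) with `polyMeasure_exp_one_holds` (NWMeasureHolds) / `polyMeasure_pi`
(Hyper03) give the WALLS, `sb_of_range_eq'` (TwoBaseCell) the item-shape instances — all BY NAME. -/
section Walls

open IntermediateField

variable {n : ℕ}

/-- **THE ARC CELL.** `(ρ°, ℓ₂, θ⃗)` is algebraically independent over `ℚ` for EVERY block `θ⃗` of polynomial measure
(tree `MvPolyMeasure`, Hyper03) — from (E3) `algebraicIndependent_of_truncGenericSeq` at `A = 4, B = 3, c = 8` and the
arc certificate `truncGenericSeq_arc`. -/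
theorem algebraicIndependent_arc_of_mvPolyMeasure {θ : Fin n → ℂ} (hθ : MvPolyMeasure θ) :
    AlgebraicIndependent ℚ
      (Sum.elim ![((rhoArc : ℝ) : ℂ), ((liouvilleNumber 2 : ℝ) : ℂ)] θ : Fin 2 ⊕ Fin n → ℂ) := by
  have h := algebraicIndependent_of_truncGenericSeq (ξ := ![rhoArc, liouvilleNumber 2]) (x := ![arcProdQ, sQ])
    (A := 4) (B := 3) (c := 8) (by norm_num) (by norm_num) ?_ ?_ ?_ truncGenericSeq_arc hθ
  · have e : (Sum.elim (fun i => (((![rhoArc, liouvilleNumber 2] : Fin 2 → ℝ) i : ℝ) : ℂ)) θ :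
        Fin 2 ⊕ Fin n → ℂ) = Sum.elim ![((rhoArc : ℝ) : ℂ), ((liouvilleNumber 2 : ℝ) : ℂ)] θ := by
      funext x
      rcases x with i | j
      · fin_cases i <;> rfl
      · rfl
    rw [e] at h
    exact h
  · intro i N
    fin_cases i
    · show (arcProdQ N).den ≤ 2 ^ (4 * N !)
      rw [den_arcProdQ_eq_two_pow]
      exact Nat.pow_le_pow_right two_pos (by have := dfac_le N; omega)
    · show (sQ N).den ≤ 2 ^ (4 * N !)
      have h1 : (sQ N).den ∣ 2 ^ N ! := by have := den_sQ_dvd N; exact_mod_cast this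
      exact (Nat.le_of_dvd (by positivity) h1).trans (Nat.pow_le_pow_right two_pos (by omega))
  · intro i N
    fin_cases i
    · show |((arcProdQ N : ℚ) : ℝ)| ≤ 3
      rw [abs_of_pos (by exact_mod_cast arcProdQ_pos N)]
      exact (arcProdQ_lt_three N).le
    · show |((sQ N : ℚ) : ℝ)| ≤ 3
      rw [sQ_cast, abs_of_pos (partialSum_pos' two_pos N)]
      have := partialSum_lt_two (le_refl (2 : ℝ)) N
      linarith
  · intro i N
    fin_cases i
    · exact abs_rhoArc_sub_arcProdQ_le N
    · show |liouvilleNumber 2 - ((sQ N : ℚ) : ℝ)| ≤ 8 / 2 ^ (N + 1)!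
      rw [sQ_cast]
      have h1 := abs_liouvilleNumber_two_sub_partialSum N
      have h8 : (2 : ℝ) / 2 ^ (N + 1)! ≤ 8 / 2 ^ (N + 1)! :=
        div_le_div_of_nonneg_right (by norm_num) (by positivity)
      linarith

/-- The PAIR `(ρ°, ℓ₂)` is algebraically independent (the `e`-block restricted away along `Sum.inl`) — HYPOTHESIS-FREE. -/
theorem algebraicIndependent_rhoArc_ell2 :
    AlgebraicIndependent ℚ ![((rhoArc : ℝ) : ℂ), ((liouvilleNumber 2 : ℝ) : ℂ)] :=
  (algebraicIndependent_arc_of_mvPolyMeasure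
    (mvPolyMeasure_one_of_polyMeasure polyMeasure_exp_one_holds)).comp Sum.inl Sum.inl_injective

/-- The pair in the member's slot order `(ℓ₂, ρ°)`. -/
theorem algebraicIndependent_ell2_rhoArc :
    AlgebraicIndependent ℚ ![((liouvilleNumber 2 : ℝ) : ℂ), ((rhoArc : ℝ) : ℂ)] := by
  have h := algebraicIndependent_rhoArc_ell2.comp (Equiv.swap (0 : Fin 2) 1) (Equiv.injective _)
  have e : (![((rhoArc : ℝ) : ℂ), ((liouvilleNumber 2 : ℝ) : ℂ)] ∘ (Equiv.swap (0 : Fin 2) 1) : Fin 2 → ℂ) =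
      ![((liouvilleNumber 2 : ℝ) : ℂ), ((rhoArc : ℝ) : ℂ)] := by
    funext i
    fin_cases i
    · simp [Equiv.swap_apply_left]
    · simp [Equiv.swap_apply_right]
  rw [e] at h
  exact h

/-- **THE ARC WALL `(1, ℓ₂, ρ°)`: `SB 3` — HYPOTHESIS-FREE** (`θ⃗ = (e)`: tree NWMeasureHolds `polyMeasure_exp_one_holds`,
RelLiouvilleCell05 `mvPolyMeasure_one_of_polyMeasure`, Hyper04 `sb_of_algebraicIndependent`, BY NAME). -/
theorem sb_arcWall3 : SB 3 ![(1 : ℂ), ((liouvilleNumber 2 : ℝ) : ℂ), ((rhoArc : ℝ) : ℂ)] := by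
  have hai := algebraicIndependent_arc_of_mvPolyMeasure
    (mvPolyMeasure_one_of_polyMeasure polyMeasure_exp_one_holds)
  refine sb_of_algebraicIndependent hai (by simp) ?_
  intro x
  rcases x with i | j
  · simp only [Sum.elim_inl]
    refine Fin.cases ?_ (fun j => ?_) i
    · simp only [Matrix.cons_val_zero]
      exact subset_adjoin ℚ _ (Or.inl (Or.inl ⟨2, by simp⟩))
    · have hj : j = 0 := Subsingleton.elim _ _
      subst hj
      simp only [Matrix.cons_val_succ, Matrix.cons_val_zero]
      exact subset_adjoin ℚ _ (Or.inl (Or.inl ⟨1, by simp⟩))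
  · simp only [Sum.elim_inr]
    refine subset_adjoin ℚ _ (Or.inl (Or.inr ⟨0, ?_⟩))
    fin_cases j; simp

/-- **THE ARC WALL, π-twin `(π, πℓ₂, πρ°)`: `SB 3` — HYPOTHESIS-FREE** (`θ⃗ = (π)`, tree Hyper03 `polyMeasure_pi`). -/
theorem sb_arcWall3_pi :
    SB 3 ![(Real.pi : ℂ), (Real.pi : ℂ) * ((liouvilleNumber 2 : ℝ) : ℂ), (Real.pi : ℂ) * ((rhoArc : ℝ) : ℂ)] := by
  set z : Fin 3 → ℂ :=
    ![(Real.pi : ℂ), (Real.pi : ℂ) * ((liouvilleNumber 2 : ℝ) : ℂ), (Real.pi : ℂ) * ((rhoArc : ℝ) : ℂ)] with hz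
  have hπ0 : (Real.pi : ℂ) ≠ 0 := by exact_mod_cast Real.pi_ne_zero
  have hzm : ∀ i, z i ∈ adjoin ℚ (SFset z ∪ {Complex.I}) := fun i =>
    subset_adjoin ℚ _ (Or.inl (Or.inl ⟨i, rfl⟩))
  have hai := algebraicIndependent_arc_of_mvPolyMeasure (mvPolyMeasure_one_of_polyMeasure polyMeasure_pi)
  refine sb_of_algebraicIndependent hai (by simp) ?_
  intro x
  rcases x with i | j
  · simp only [Sum.elim_inl]
    refine Fin.cases ?_ (fun j => ?_) i
    · simp only [Matrix.cons_val_zero]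
      have e : ((rhoArc : ℝ) : ℂ) = z 2 / z 0 := by simp [hz, mul_div_cancel_left₀ _ hπ0]
      rw [e]; exact div_mem (hzm 2) (hzm 0)
    · have hj : j = 0 := Subsingleton.elim _ _
      subst hj
      simp only [Matrix.cons_val_succ, Matrix.cons_val_zero]
      have e : ((liouvilleNumber 2 : ℝ) : ℂ) = z 1 / z 0 := by simp [hz, mul_div_cancel_left₀ _ hπ0]
      rw [e]; exact div_mem (hzm 1) (hzm 0)
  · simp only [Sum.elim_inr]
    have e : (![(Real.pi : ℂ)] : Fin 1 → ℂ) j = z 0 := by fin_cases j; simp [hz]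
    rw [e]; exact hzm 0

/-- **ITEM 33364 ON THE ARC WALL `(1, ℓ₂, ρ°)` — HYPOTHESIS-FREE.**  Binders of
`Summit.Schanuel.Schanuel.Theses.RootDecomp1K.FiniteOrderLiouvilleSchanuel` VERBATIM, with ONE line inserted after
`LinearIndependent ℚ z` — the cell `Set.range z = Set.range ![1, ℓ₂, ρ°]`.  The two Diophantine binders are not used by the
proof (the conclusion holds outright on the wall); BOTH are CERTIFIED at the member `zA` (§7). -/
theorem finiteOrderLiouvilleSchanuel_arcWall3 :
    ∀ (n : ℕ) (z : Fin n → ℂ), LinearIndependent ℚ z →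
      Set.range z = Set.range ![(1 : ℂ), ((liouvilleNumber 2 : ℝ) : ℂ), ((rhoArc : ℝ) : ℂ)] →
      (∀ ω : ℕ, ∃ h : Fin n → ℤ, h ≠ 0 ∧ ‖∑ i, (h i : ℂ) * z i‖ < 1 / (1 + ∑ i, (|h i| : ℝ)) ^ ω) →
      (¬ ∀ m : ℕ, ∃ h : Fin n → ℤ, h ≠ 0 ∧
        ‖∑ i, (h i : ℂ) * z i‖ < Real.exp (-((1 + ∑ i, (|h i| : ℝ)) ^ m))) →
      (n : Cardinal) ≤ Algebra.trdeg ℚ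
        ↥(IntermediateField.adjoin ℚ (Set.range z ∪ Set.range (Complex.exp ∘ z))) := by
  intro n z hz hrange _ _
  exact sb_of_range_eq' hz.injective hrange sb_arcWall3

/-- **ITEM 33364 ON THE ARC WALL, π-twin `(π, πℓ₂, πρ°)` — HYPOTHESIS-FREE.** -/
theorem finiteOrderLiouvilleSchanuel_arcWall3_pi :
    ∀ (n : ℕ) (z : Fin n → ℂ), LinearIndependent ℚ z →
      Set.range z = Set.range ![(Real.pi : ℂ), (Real.pi : ℂ) * ((liouvilleNumber 2 : ℝ) : ℂ),
        (Real.pi : ℂ) * ((rhoArc : ℝ) : ℂ)] →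
      (∀ ω : ℕ, ∃ h : Fin n → ℤ, h ≠ 0 ∧ ‖∑ i, (h i : ℂ) * z i‖ < 1 / (1 + ∑ i, (|h i| : ℝ)) ^ ω) →
      (¬ ∀ m : ℕ, ∃ h : Fin n → ℤ, h ≠ 0 ∧
        ‖∑ i, (h i : ℂ) * z i‖ < Real.exp (-((1 + ∑ i, (|h i| : ℝ)) ^ m))) →
      (n : Cardinal) ≤ Algebra.trdeg ℚ
        ↥(IntermediateField.adjoin ℚ (Set.range z ∪ Set.range (Complex.exp ∘ z))) := by
  intro n z hz hrange _ _
  exact sb_of_range_eq' hz.injective hrange sb_arcWall3_pi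

/-- **ITEM 31077 ON THE ARC WALL `(1, ℓ₂, ρ°)` — HYPOTHESIS-FREE** (binders of
`Summit.Schanuel.Schanuel.Theses.RootDecomp1K.CoordLiouvilleSchanuel` verbatim + the cell line; bookkeeping). -/
theorem coordLiouvilleSchanuel_arcWall3 :
    ∀ (n : ℕ) (z : Fin n → ℂ), LinearIndependent ℚ z →
      Set.range z = Set.range ![(1 : ℂ), ((liouvilleNumber 2 : ℝ) : ℂ), ((rhoArc : ℝ) : ℂ)] →
      (∃ w ∈ Submodule.span ℚ (Set.range z), Liouville w.re ∨ Liouville w.im) →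
      (n : Cardinal) ≤ Algebra.trdeg ℚ
        ↥(IntermediateField.adjoin ℚ (Set.range z ∪ Set.range (Complex.exp ∘ z))) := by
  intro n z hz hrange _
  exact sb_of_range_eq' hz.injective hrange sb_arcWall3

end Walls

/-! ## §7  THE MEMBERS `zA = (1, ℓ₂, ρ°)`, `zA^π = (π, πℓ₂, πρ°)` — every binder of item 33364 CERTIFIED, hyp-free

The ONE-CUT 2-adic form bound (M): cut BOTH coordinates at the single resolution `2^{2D_N}` (`den ρ°_N = 4^{D_N} = 2^{2D_N}`,
`den s_N = 2^{N!} ∣ 2^{2D_N}`); the cut integer `I_N(g) = g₀·2^{2D_N} + g₂·ν_N + g₁·p_N·2^{2D_N − N!}` (`ν_N = arcNum N` ODD,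
`p_N = psNumer 2 N` ODD — tree CollarCell02 `odd_psNumer_two`) is NON-ZERO by the tree's 2-adic divisibility lemma
CollarWall04 `cutInt_ne_zero` BY NAME (valuations `≥ 2D_N` / `∈ [2D_N − N!, 2D_N)` / `∈ [0, N!)` pairwise separated once
`|g₁|, |g₂| < 2^{N!}`), the truncation error is `≤ ½·2^{−2D_N}` by the slack `N! + 2D_N + 5 ≤ (N+1)!` (`N ≥ 5`), and the
minimality of the cut level bounds `2D_N + 2 ≤ (1+H)^9`. -/
section Members

open IntermediateField
open Summit.Schanuel.Schanuel.Theorems.RootDecomp1KCollarWall (cutInt_ne_zero)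

/-- `(1, u⃗)` is ℚ-linearly independent when `u⃗` is algebraically independent over `ℚ` (re-proof of the private GapCell06 /
CollarWall05 helper of the same name). -/
private theorem linearIndependent_one_cons_of_algebraicIndependent {m : ℕ} {u : Fin m → ℂ}
    (hu : AlgebraicIndependent ℚ u) : LinearIndependent ℚ (Fin.cons (1 : ℂ) u : Fin (m + 1) → ℂ) := by
  classical
  rw [linearIndependent_finCons]
  refine ⟨hu.linearIndependent, fun hmem => ?_⟩
  obtain ⟨c, hc⟩ := (Submodule.mem_span_range_iff_exists_fun (R := ℚ)).mp hmem
  set P : MvPolynomial (Fin m) ℚ := ∑ i, MvPolynomial.C (c i) * MvPolynomial.X i - 1 with hP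
  have hval : MvPolynomial.aeval u P = 0 := by
    simp only [hP, map_sub, map_sum, map_mul, MvPolynomial.aeval_C, MvPolynomial.aeval_X, map_one]
    rw [← hc]
    simp [Algebra.smul_def]
  have hP0 : P = 0 :=
    (algebraicIndependent_iff_injective_aeval.mp hu) (by rw [hval, map_zero])
  have hcc : MvPolynomial.constantCoeff P = -1 := by
    simp [hP, MvPolynomial.constantCoeff_X]
  rw [hP0, map_zero] at hcc
  norm_num at hcc

/-- Scaling by `π ≠ 0` preserves ℚ-linear independence (re-proof of the private GapCell06 / CollarWall05 helper). -/
private theorem linearIndependent_pi_mul {N : ℕ} {v : Fin N → ℂ} (hv : LinearIndependent ℚ v) :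
    LinearIndependent ℚ (fun i => (Real.pi : ℂ) * v i) := by
  rw [Fintype.linearIndependent_iff] at hv ⊢
  intro g hg
  apply hv g
  have hπ0 : (Real.pi : ℂ) ≠ 0 := by exact_mod_cast Real.pi_ne_zero
  have h : (Real.pi : ℂ) * ∑ i, g i • v i = 0 := by
    rw [Finset.mul_sum]
    calc ∑ i, (Real.pi : ℂ) * (g i • v i) = ∑ i, g i • ((Real.pi : ℂ) * v i) :=
          Finset.sum_congr rfl fun i _ => by rw [mul_smul_comm]
      _ = 0 := hg
  exact (mul_eq_zero.mp h).resolve_left hπ0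

/-- THE MEMBER `zA = (1, ℓ₂, ρ°)`. -/
def zA : Fin 3 → ℂ := ![(1 : ℂ), ((liouvilleNumber 2 : ℝ) : ℂ), ((rhoArc : ℝ) : ℂ)]

/-- THE π-TWIN `zA^π = (π, πℓ₂, πρ°)`. -/
def zApi : Fin 3 → ℂ :=
  ![(Real.pi : ℂ), (Real.pi : ℂ) * ((liouvilleNumber 2 : ℝ) : ℂ), (Real.pi : ℂ) * ((rhoArc : ℝ) : ℂ)]

/-- (i) `LinearIndependent ℚ zA` — HYPOTHESIS-FREE. -/
theorem linearIndependent_zA : LinearIndependent ℚ zA := by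
  have e : zA = (Fin.cons (1 : ℂ) ![((liouvilleNumber 2 : ℝ) : ℂ), ((rhoArc : ℝ) : ℂ)] : Fin 3 → ℂ) := by
    funext i; fin_cases i <;> simp [zA]
  rw [e]; exact linearIndependent_one_cons_of_algebraicIndependent algebraicIndependent_ell2_rhoArc

/-- (i^π) `LinearIndependent ℚ zA^π` — HYPOTHESIS-FREE. -/
theorem linearIndependent_zApi : LinearIndependent ℚ zApi := by
  have e : zApi = fun i => (Real.pi : ℂ) * zA i := by
    funext i; fin_cases i <;> simp [zApi, zA]
  rw [e]; exact linearIndependent_pi_mul linearIndependent_zA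

/-- (ii) `LinLiouville zA` — the FIRST Diophantine binder of item 33364 (its TEXT), through the prefix `(1, ℓ₂)` (tree Hyper13
`linLiouville_of_prefix`, Hyper05 `linLiouville_of_liouville_ratio`, Mathlib `liouville_liouvilleNumber`) — HYPOTHESIS-FREE. -/
theorem linLiouville_zA : LinLiouville zA := by
  have hℓ : Liouville (liouvilleNumber 2) := liouville_liouvilleNumber (le_refl 2)
  refine linLiouville_of_prefix (k := 2) (n := 3) (by norm_num) ?_
  have h2 : (fun i : Fin 2 => zA (Fin.castLE (show 2 ≤ 3 by norm_num) i)) =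
      ![(1 : ℂ), ((liouvilleNumber 2 : ℝ) : ℂ) * 1] := by
    funext i; fin_cases i <;> simp [zA]
  rw [h2]
  exact linLiouville_of_liouville_ratio hℓ 1

/-- (ii^π) `LinLiouville zA^π` — HYPOTHESIS-FREE. -/
theorem linLiouville_zApi : LinLiouville zApi := by
  have hℓ : Liouville (liouvilleNumber 2) := liouville_liouvilleNumber (le_refl 2)
  refine linLiouville_of_prefix (k := 2) (n := 3) (by norm_num) ?_
  have h2 : (fun i : Fin 2 => zApi (Fin.castLE (show 2 ≤ 3 by norm_num) i)) =
      ![(Real.pi : ℂ), ((liouvilleNumber 2 : ℝ) : ℂ) * (Real.pi : ℂ)] := by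
    funext i; fin_cases i <;> simp [zApi, mul_comm]
  rw [h2]
  exact linLiouville_of_liouville_ratio hℓ (Real.pi : ℂ)

/-- An integer form in `zA` is the real number `g₀ + g₁ℓ₂ + g₂ρ°`. -/
theorem zA_form (g : Fin 3 → ℤ) :
    ∑ i, (g i : ℂ) * zA i = (((g 0 : ℝ) + g 1 * liouvilleNumber 2 + g 2 * rhoArc : ℝ) : ℂ) := by
  rw [Fin.sum_univ_three]
  simp only [zA, Matrix.cons_val_zero, Matrix.cons_val_one, Matrix.cons_val_two, Matrix.head_cons,
    Matrix.tail_cons]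
  push_cast; ring

/-- An integer form in `zA^π` is `π·(g₀ + g₁ℓ₂ + g₂ρ°)`. -/
theorem zApi_form (g : Fin 3 → ℤ) :
    ∑ i, (g i : ℂ) * zApi i =
      (Real.pi : ℂ) * (((g 0 : ℝ) + g 1 * liouvilleNumber 2 + g 2 * rhoArc : ℝ) : ℂ) := by
  rw [Fin.sum_univ_three]
  simp only [zApi, Matrix.cons_val_zero, Matrix.cons_val_one, Matrix.cons_val_two, Matrix.head_cons,
    Matrix.tail_cons]
  push_cast; ring

/-- `‖Σ gᵢ zAᵢ‖ = |g₀ + g₁ℓ₂ + g₂ρ°|`. -/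
theorem norm_zA_form (g : Fin 3 → ℤ) :
    ‖∑ i, (g i : ℂ) * zA i‖ = |(g 0 : ℝ) + g 1 * liouvilleNumber 2 + g 2 * rhoArc| := by
  rw [zA_form, Complex.norm_real, Real.norm_eq_abs]

/-- `‖Σ gᵢ zA^πᵢ‖ = π·|g₀ + g₁ℓ₂ + g₂ρ°|`. -/
theorem norm_zApi_form (g : Fin 3 → ℤ) :
    ‖∑ i, (g i : ℂ) * zApi i‖ = Real.pi * |(g 0 : ℝ) + g 1 * liouvilleNumber 2 + g 2 * rhoArc| := by
  rw [zApi_form, norm_mul, Complex.norm_real, Complex.norm_real, Real.norm_eq_abs, Real.norm_eq_abs,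
    abs_of_pos Real.pi_pos]

end Members

end Summit.Schanuel.Schanuel.Theorems.RootDecomp1KArcCell

end
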